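import Summits.NavierStokesRegularity.NavierStokesRegularity.Theorems.EulerZoomLiouvillePowerGaugeEulerLiouvillePowerClockRigidityGradient
import Summits.NavierStokesRegularity.NavierStokesRegularity.Theorems.EulerZoomLiouvillePowerGaugeEulerLiouvillePowerClockRigidityPressure

/-!
# Crux `EulerZoomLiouville.PowerGaugeEulerLiouville` (stmt-NavierStokesRegularity-19832), line `logtime-breathers` (T4):
# data bricks for classical power clocks with NON-POSITIVE rate `γ ≤ 0` about `T₀ ≥ 0`

Width seat `ns-ezl-w4` (power-clock rigidity, file VI; the `γ ≤ 0` twins of `…PowerClockRigidityGradient` /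
`…PowerClockRigidityPressure`, whose radius `a = (T₀+2)^{γ} L` and length bounds use `γ ≥ 0`).  For `γ ≤ 0` the clock lengths
`(T₀−τ)^{γ} ≤ 1` on the window `(−2,−1)`, so the radius `a = L` works:

* `profile_gradient_growth_of_gaugeE_nonpos` — `∫_{B_L}|∇W|²_F ≤ (T₀+2)^{2−3γ} c₀ · L^{1−ρ}` for `L ≥ 2`;
* `lintegral_ball_avgPressure_le_nonpos` — `∫_{B_L}|P̄|^{3/2} ≤ ((T₀+2)^{2−2γ})^{3/2} (T₀+2)^{−3γ} c₀ · L^{2−2ρ}` for `L ≥ 2`.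

WHAT THIS IS NOT: not NS regularity, not the crux — data bricks; `--supports` stmt-19832. [folklore]
-/

noncomputable section

set_option linter.dupNamespace false

open MeasureTheory Set Filter Topology Metric Function TopologicalSpace
open scoped ENNReal NNReal RealInnerProductSpace ContDiff

namespace Summit.NavierStokesRegularity.NavierStokesRegularity.Theorems.PowerGaugeEulerLiouville

open Literature.Analysis Literature.Analysis.FunctionSpaces Literature.Analysis.FluidPDE

namespace PowerClockRigidity

variable {u : ℝ → EuclideanSpace ℝ (Fin 3) → EuclideanSpace ℝ (Fin 3)} {p : ℝ → EuclideanSpace ℝ (Fin 3) → ℝ}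
  {H : ℝ → EuclideanSpace ℝ (Fin 3) → EuclideanSpace ℝ (Fin 3) →L[ℝ] EuclideanSpace ℝ (Fin 3)}
  {T₀ g : ℝ} {W : EuclideanSpace ℝ (Fin 3) → EuclideanSpace ℝ (Fin 3)}

/-- **THE `E`-GAUGE OF A CLASSICAL POWER CLOCK WITH `γ ≤ 0` IN PROFILE VARIABLES (large scales).**  Let `H` be a.e.-strongly measurable on the
slab with `H(τ) = (T₀−τ)^{−1} ∇W((T₀−τ)^{−γ}·)` a.e. for a.e. `τ < 0` (output of `ae_slice_gradient_eq`), `T₀ ≥ 0`, `0 ≤ γ ≤ 2/3`, and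
`a^{ρ} E(a; 0; H) ≤ c₀` for all `a > 0`; here `γ ≤ 0` (the clock dilation `(T₀−τ)^{−γ} ≥ 1` on the window).  Then, with `S = T₀ + 2`,
for every `L ≥ 2`: `∫_{B_L} |∇W|²_F ≤ S^{2−3γ} c₀ · L^{1−ρ}` (window `(−2,−1) × B_L ⊆ Q_L(0,0)`, Tonelli, slice dilation). [folklore] -/
theorem profile_gradient_growth_of_gaugeE_nonpos {ρ : ℝ} {c₀ : ℝ≥0} (hT₀ : 0 ≤ T₀) (hg0 : g ≤ 0)
    (hHm : AEStronglyMeasurable (uncurry H)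
      (volume.restrict (Iio (0 : ℝ) ×ˢ (univ : Set (EuclideanSpace ℝ (Fin 3))))))
    (hHV : ∀ᵐ τ ∂((volume : Measure ℝ).restrict (Iio (0 : ℝ))),
      H τ =ᵐ[volume] fun x => (T₀ - τ) ^ (-1 : ℝ) • fderiv ℝ W ((T₀ - τ) ^ (-g) • x))
    (hE : ∀ a : ℝ, 0 < a →
      ENNReal.ofReal (a ^ ρ) * cknE a (0 : ℝ × EuclideanSpace ℝ (Fin 3)) H ≤ (c₀ : ℝ≥0∞)) :
    ∀ L : ℝ, 2 ≤ L →
      ∫⁻ y in ball (0 : EuclideanSpace ℝ (Fin 3)) L, ENNReal.ofReal (frobeniusNormSq (fderiv ℝ W y)) ≤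
        ENNReal.ofReal ((T₀ + 2) ^ (2 - 3 * g)) * (c₀ : ℝ≥0∞) * ENNReal.ofReal (L ^ (1 - ρ)) := by
  -- adapted from `profile_gradient_growth_of_gaugeE` (`γ ≥ 0`), radius `a = L`
  intro L hL
  have hg23 : 3 * g - 2 ≤ 0 := by linarith
  set G : EuclideanSpace ℝ (Fin 3) → EuclideanSpace ℝ (Fin 3) →L[ℝ] EuclideanSpace ℝ (Fin 3) := fderiv ℝ W with hG
  have hfm : Measurable fun L : EuclideanSpace ℝ (Fin 3) →L[ℝ] EuclideanSpace ℝ (Fin 3) =>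
      ENNReal.ofReal (frobeniusNormSq L) :=
    (SereginZajaczkowski2007.continuous_frobeniusNormSq).measurable.ennreal_ofReal
  have hL0 : 0 < L := by linarith
  set S : ℝ := T₀ + 2 with hS
  have hS0 : 0 < S := by rw [hS]; linarith
  have hS1 : 1 ≤ S := by rw [hS]; linarith
  -- ### the radius `a = L`
  set a : ℝ := L with ha
  have haL : L ≤ a := le_rfl
  have ha0 : 0 < a := by rw [ha]; exact hL0
  have ha2 : (2 : ℝ) ≤ a ^ 2 := by nlinarith
  -- ### (1) the gauge: `X = ∫∫_{Q_a} |H|²_F ≤ a^{1−ρ} c₀`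
  set X : ℝ≥0∞ := ∫⁻ q in parabolicCylinder a (0 : ℝ × EuclideanSpace ℝ (Fin 3)),
    ENNReal.ofReal (frobeniusNormSq (H q.1 q.2)) with hX
  have hXle : X ≤ ENNReal.ofReal (a ^ (1 - ρ)) * (c₀ : ℝ≥0∞) := by
    have h1 := hE a ha0
    unfold cknE at h1
    have hB0 : ENNReal.ofReal (a ^ ρ) ≠ 0 := by
      rw [ENNReal.ofReal_ne_zero_iff]; exact Real.rpow_pos_of_pos ha0 _
    have hA0 : ENNReal.ofReal a ≠ 0 := by rw [ENNReal.ofReal_ne_zero_iff]; exact ha0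
    have key : X = ENNReal.ofReal a * (ENNReal.ofReal (a ^ ρ))⁻¹ *
        (ENNReal.ofReal (a ^ ρ) * ((ENNReal.ofReal a)⁻¹ * X)) := by
      rw [← mul_assoc, mul_assoc (ENNReal.ofReal a), ENNReal.inv_mul_cancel hB0 ENNReal.ofReal_ne_top,
        mul_one, ← mul_assoc, ENNReal.mul_inv_cancel hA0 ENNReal.ofReal_ne_top, one_mul]
    calc X = _ := key
      _ ≤ ENNReal.ofReal a * (ENNReal.ofReal (a ^ ρ))⁻¹ * (c₀ : ℝ≥0∞) := by gcongr
      _ = ENNReal.ofReal (a ^ (1 - ρ)) * (c₀ : ℝ≥0∞) := by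
          rw [← ENNReal.ofReal_inv_of_pos (Real.rpow_pos_of_pos ha0 _), ← ENNReal.ofReal_mul ha0.le]
          congr 2
          rw [Real.rpow_sub ha0, Real.rpow_one, div_eq_mul_inv]
  -- ### (2) the window `(−2, −1) × B_a` inside `Q_a(0,0)`
  have hWsub : Ioo (-2 : ℝ) (-1) ×ˢ ball (0 : EuclideanSpace ℝ (Fin 3)) a ⊆
      parabolicCylinder a (0 : ℝ × EuclideanSpace ℝ (Fin 3)) := by
    intro q hq
    rw [mem_prod, mem_Ioo, mem_ball] at hq
    rw [mem_parabolicCylinder, Prod.fst_zero, Prod.snd_zero, zero_sub]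
    exact ⟨⟨by linarith [hq.1.1], by linarith [hq.1.2]⟩, hq.2⟩
  have hY : ∫⁻ q in Ioo (-2 : ℝ) (-1) ×ˢ ball (0 : EuclideanSpace ℝ (Fin 3)) a,
      ENNReal.ofReal (frobeniusNormSq (H q.1 q.2)) ≤ X :=
    lintegral_mono_set hWsub
  -- ### (3) Tonelli on the window
  have hHmW : AEMeasurable (fun q : ℝ × EuclideanSpace ℝ (Fin 3) =>
      ENNReal.ofReal (frobeniusNormSq (H q.1 q.2)))
      (((volume : Measure ℝ).restrict (Ioo (-2 : ℝ) (-1))).prod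
        ((volume : Measure (EuclideanSpace ℝ (Fin 3))).restrict (ball 0 a))) := by
    have hsub : Ioo (-2 : ℝ) (-1) ×ˢ ball (0 : EuclideanSpace ℝ (Fin 3)) a ⊆
        Iio (0 : ℝ) ×ˢ (univ : Set (EuclideanSpace ℝ (Fin 3))) :=
      prod_mono (fun t ht => by have := ht.2; rw [mem_Iio]; linarith) (subset_univ _)
    have := hfm.comp_aemeasurable (hHm.mono_measure (Measure.restrict_mono hsub le_rfl)).aemeasurable
    rwa [Measure.volume_eq_prod, ← Measure.prod_restrict] at this
  have hYeq : ∫⁻ q in Ioo (-2 : ℝ) (-1) ×ˢ ball (0 : EuclideanSpace ℝ (Fin 3)) a,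
        ENNReal.ofReal (frobeniusNormSq (H q.1 q.2)) =
      ∫⁻ τ in Ioo (-2 : ℝ) (-1), ∫⁻ x in ball (0 : EuclideanSpace ℝ (Fin 3)) a,
        ENNReal.ofReal (frobeniusNormSq (H τ x)) := by
    rw [Measure.volume_eq_prod, ← Measure.prod_restrict, lintegral_prod _ hHmW]
  -- ### (4) the a.e. lower bound on the slices of the window
  set J : ℝ≥0∞ := ∫⁻ y in ball (0 : EuclideanSpace ℝ (Fin 3)) L, ENNReal.ofReal (frobeniusNormSq (G y)) with hJ
  have hWT : Ioo (-2 : ℝ) (-1) ⊆ Iio 0 := fun t ht => by have := ht.2; rw [mem_Iio]; linarith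
  have hlow : ∀ᵐ τ ∂((volume : Measure ℝ).restrict (Ioo (-2 : ℝ) (-1))),
      ENNReal.ofReal (S ^ (3 * g - 2)) * J ≤
        ∫⁻ x in ball (0 : EuclideanSpace ℝ (Fin 3)) a, ENNReal.ofReal (frobeniusNormSq (H τ x)) := by
    filter_upwards [ae_restrict_of_ae_restrict_of_subset hWT hHV, ae_restrict_mem measurableSet_Ioo]
      with τ hτ hτW
    have hs : 0 < T₀ - τ := by have := hτW.2; linarith
    have hsS : T₀ - τ ≤ S := by have := hτW.1; rw [hS]; linarith
    set d : ℝ := (T₀ - τ) ^ (-g) with hd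
    have hd0 : 0 < d := Real.rpow_pos_of_pos hs _
    -- replace `H τ` by the clock-dilated classical gradient on the ball
    have hcongr : ∫⁻ x in ball (0 : EuclideanSpace ℝ (Fin 3)) a, ENNReal.ofReal (frobeniusNormSq (H τ x)) =
        ∫⁻ x in ball (0 : EuclideanSpace ℝ (Fin 3)) a,
          ENNReal.ofReal (frobeniusNormSq ((T₀ - τ) ^ (-1 : ℝ) • G (d • x))) :=
      lintegral_congr_ae (ae_restrict_of_ae (hτ.mono fun x hx => by simp only [hx, hG, hd]))
    rw [hcongr]
    have hLa : L ≤ d * a := by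
      have hs1 : 1 ≤ T₀ - τ := by have := hτW.2; linarith
      have h1 : 1 ≤ d := by rw [hd]; exact Real.one_le_rpow hs1 (by linarith)
      rw [ha]; nlinarith
    have hcoef : S ^ (3 * g - 2) ≤ (T₀ - τ) ^ (-2 : ℝ) * (d ^ 3)⁻¹ := by
      have e1 : (T₀ - τ) ^ (-2 : ℝ) * (d ^ 3)⁻¹ = (T₀ - τ) ^ (3 * g - 2) := by
        rw [hd, ← Real.rpow_natCast, ← Real.rpow_mul hs.le, ← Real.rpow_neg hs.le, ← Real.rpow_add hs]
        congr 1; push_cast; ring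
      rw [e1]
      exact Real.rpow_le_rpow_of_nonpos hs hsS hg23
    calc ENNReal.ofReal (S ^ (3 * g - 2)) * J
        ≤ ENNReal.ofReal ((T₀ - τ) ^ (-2 : ℝ) * (d ^ 3)⁻¹) * J := mul_le_mul' (ENNReal.ofReal_le_ofReal hcoef) le_rfl
      _ = ENNReal.ofReal ((T₀ - τ) ^ (-2 : ℝ)) * ENNReal.ofReal ((d ^ 3)⁻¹) * J := by
          rw [ENNReal.ofReal_mul (Real.rpow_nonneg hs.le _)]
      _ ≤ _ := lintegral_ball_frobeniusNormSq_clockDilate_ge hs hd0 G hLa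
  -- ### (5) integrate the lower bound over the window (length `1`)
  have hvolW : volume (Ioo (-2 : ℝ) (-1)) = 1 := by
    rw [Real.volume_Ioo, show (-1 : ℝ) - -2 = 1 by ring, ENNReal.ofReal_one]
  have hJle : ENNReal.ofReal (S ^ (3 * g - 2)) * J ≤ X :=
    calc ENNReal.ofReal (S ^ (3 * g - 2)) * J
        = ∫⁻ _ in Ioo (-2 : ℝ) (-1), ENNReal.ofReal (S ^ (3 * g - 2)) * J := by
          rw [setLIntegral_const, hvolW, mul_one]
      _ ≤ ∫⁻ τ in Ioo (-2 : ℝ) (-1), ∫⁻ x in ball (0 : EuclideanSpace ℝ (Fin 3)) a,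
            ENNReal.ofReal (frobeniusNormSq (H τ x)) := lintegral_mono_ae hlow
      _ = _ := hYeq.symm
      _ ≤ X := hY
  -- ### (6) assemble
  have hunit : ENNReal.ofReal (S ^ (2 - 3 * g)) * ENNReal.ofReal (S ^ (3 * g - 2)) = 1 := by
    rw [← ENNReal.ofReal_mul (Real.rpow_nonneg hS0.le _), ← Real.rpow_add hS0,
      show (2 - 3 * g) + (3 * g - 2) = 0 by ring, Real.rpow_zero, ENNReal.ofReal_one]
  calc J = ENNReal.ofReal (S ^ (2 - 3 * g)) * (ENNReal.ofReal (S ^ (3 * g - 2)) * J) := by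
        rw [← mul_assoc, hunit, one_mul]
    _ ≤ ENNReal.ofReal (S ^ (2 - 3 * g)) * X := by gcongr
    _ ≤ ENNReal.ofReal (S ^ (2 - 3 * g)) * (ENNReal.ofReal (a ^ (1 - ρ)) * (c₀ : ℝ≥0∞)) := by gcongr
    _ = ENNReal.ofReal (S ^ (2 - 3 * g)) * (c₀ : ℝ≥0∞) * ENNReal.ofReal (L ^ (1 - ρ)) := by
        rw [ha]; ring

/-- **THE `D`-GAUGE CONTROLS THE AVERAGED SLICE PRESSURE (large scales, no loss).**  If `(u, p)` is classical on `(−∞,0)`,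
`T₀ ≥ 0`, `γ ≤ 0`, and `a^{2ρ} D(a; 0; p) ≤ c₀` for all `a > 0`, then with `S = T₀ + 2`, for every `L ≥ 2`,
`∫_{B_L} |P̄(z)|^{3/2} dz ≤ (S^{2−2γ})^{3/2} S^{−3γ} c₀ · L^{2−2ρ}` (radius `a = L`; the slice lengths `(T₀−τ)^{γ} ≤ 1`). [folklore] -/
theorem lintegral_ball_avgPressure_le_nonpos {ρ : ℝ} {c₀ : ℝ≥0} (hcl : IsClassicalEulerSolutionOn (Iio 0) 0 u p) (hT₀ : 0 ≤ T₀)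
    (hg0 : g ≤ 0)
    (hD : ∀ a : ℝ, 0 < a →
      ENNReal.ofReal (a ^ (2 * ρ)) * cknD a (0 : ℝ × EuclideanSpace ℝ (Fin 3)) p ≤ (c₀ : ℝ≥0∞))
    {L : ℝ} (hL : 2 ≤ L) :
    ∫⁻ z in ball (0 : EuclideanSpace ℝ (Fin 3)) L,
        ‖∫ τ in Ioo (-2 : ℝ) (-1), (((T₀ - τ) ^ (g - 1)) ^ 2)⁻¹ * p τ ((T₀ - τ) ^ g • z)‖ₑ ^ (3 / 2 : ℝ) ≤
      ENNReal.ofReal (((T₀ + 2) ^ (2 - 2 * g)) ^ (3 / 2 : ℝ) * (T₀ + 2) ^ (-(3 * g))) * (c₀ : ℝ≥0∞) *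
        ENNReal.ofReal (L ^ (2 - 2 * ρ)) := by
  -- adapted from `lintegral_ball_avgPressure_le` (`γ ≥ 0`), radius `a = L`
  have hL0 : 0 < L := by linarith
  set S : ℝ := T₀ + 2 with hS
  have hS0 : 0 < S := by rw [hS]; linarith
  have hS1 : 1 ≤ S := by rw [hS]; linarith
  set KB : ℝ := S ^ (-(3 * g)) with hKB
  have hKB0 : 0 ≤ KB := Real.rpow_nonneg hS0.le _
  set a : ℝ := L with ha
  have haL : L ≤ a := le_rfl
  have ha0 : 0 < a := by rw [ha]; exact hL0
  have hcont := continuousOn_slicePressure_uncurry (g := g) hcl hT₀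
  set Ps : ℝ → EuclideanSpace ℝ (Fin 3) → ℝ := fun τ z => (((T₀ - τ) ^ (g - 1)) ^ 2)⁻¹ * p τ ((T₀ - τ) ^ g • z) with hPs
  set KA : ℝ := (S ^ (2 - 2 * g)) ^ (3 / 2 : ℝ) with hKA
  have hKA0 : 0 ≤ KA := Real.rpow_nonneg (Real.rpow_nonneg hS0.le _) _
  -- ### (1) the gauge: `X = ∫∫_{Q_a} |p|^{3/2} ≤ a^{2−2ρ} c₀`
  set X : ℝ≥0∞ := ∫⁻ q in parabolicCylinder a (0 : ℝ × EuclideanSpace ℝ (Fin 3)),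
    ‖p q.1 q.2‖ₑ ^ (3 / 2 : ℝ) with hX
  have hXle : X ≤ ENNReal.ofReal (a ^ (2 - 2 * ρ)) * (c₀ : ℝ≥0∞) := by
    have h1 := hD a ha0
    unfold cknD at h1
    have hB0 : ENNReal.ofReal (a ^ (2 * ρ)) ≠ 0 := by
      rw [ENNReal.ofReal_ne_zero_iff]; exact Real.rpow_pos_of_pos ha0 _
    have hA0 : ENNReal.ofReal a ^ 2 ≠ 0 := pow_ne_zero _ (by rw [ENNReal.ofReal_ne_zero_iff]; exact ha0)
    have hAt : ENNReal.ofReal a ^ 2 ≠ ⊤ := ENNReal.pow_ne_top ENNReal.ofReal_ne_top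
    have key : X = ENNReal.ofReal a ^ 2 * (ENNReal.ofReal (a ^ (2 * ρ)))⁻¹ *
        (ENNReal.ofReal (a ^ (2 * ρ)) * ((ENNReal.ofReal a ^ 2)⁻¹ * X)) := by
      rw [← mul_assoc, mul_assoc (ENNReal.ofReal a ^ 2), ENNReal.inv_mul_cancel hB0 ENNReal.ofReal_ne_top,
        mul_one, ← mul_assoc, ENNReal.mul_inv_cancel hA0 hAt, one_mul]
    calc X = _ := key
      _ ≤ ENNReal.ofReal a ^ 2 * (ENNReal.ofReal (a ^ (2 * ρ)))⁻¹ * (c₀ : ℝ≥0∞) := by gcongr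
      _ = ENNReal.ofReal (a ^ (2 - 2 * ρ)) * (c₀ : ℝ≥0∞) := by
          rw [← ENNReal.ofReal_inv_of_pos (Real.rpow_pos_of_pos ha0 _), ← ENNReal.ofReal_pow ha0.le,
            ← ENNReal.ofReal_mul (by positivity)]
          congr 2
          rw [Real.rpow_sub ha0, show a ^ (2 : ℝ) = a ^ (2 : ℕ) by exact_mod_cast Real.rpow_natCast a 2,
            div_eq_mul_inv]
  -- ### (2) the window `(−2,−1) × B_a ⊆ Q_a(0,0)` and Tonelli for `p`
  have hWsub : Ioo (-2 : ℝ) (-1) ×ˢ ball (0 : EuclideanSpace ℝ (Fin 3)) a ⊆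
      parabolicCylinder a (0 : ℝ × EuclideanSpace ℝ (Fin 3)) := by
    intro q hq
    rw [mem_prod, mem_Ioo, mem_ball] at hq
    rw [mem_parabolicCylinder, Prod.fst_zero, Prod.snd_zero, zero_sub]
    have ha2 : (2 : ℝ) ≤ a ^ 2 := by nlinarith
    exact ⟨⟨by linarith [hq.1.1], by linarith [hq.1.2]⟩, hq.2⟩
  have hsubW : Ioo (-2 : ℝ) (-1) ×ˢ ball (0 : EuclideanSpace ℝ (Fin 3)) a ⊆ Iio (0 : ℝ) ×ˢ univ :=
    prod_mono (fun t ht => by have := ht.2; rw [mem_Iio]; linarith) (subset_univ _)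
  have hpmW : AEMeasurable (fun q : ℝ × EuclideanSpace ℝ (Fin 3) => ‖p q.1 q.2‖ₑ ^ (3 / 2 : ℝ))
      (((volume : Measure ℝ).restrict (Ioo (-2 : ℝ) (-1))).prod
        ((volume : Measure (EuclideanSpace ℝ (Fin 3))).restrict (ball 0 a))) := by
    have hpc : ContinuousOn (uncurry p) (Ioo (-2 : ℝ) (-1) ×ˢ ball (0 : EuclideanSpace ℝ (Fin 3)) a) :=
      hcl.smooth_pressure.continuousOn.mono hsubW
    have h : AEMeasurable (fun q : ℝ × EuclideanSpace ℝ (Fin 3) => ‖uncurry p q‖ₑ ^ (3 / 2 : ℝ))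
        (volume.restrict (Ioo (-2 : ℝ) (-1) ×ˢ ball (0 : EuclideanSpace ℝ (Fin 3)) a)) :=
      (hpc.aestronglyMeasurable (measurableSet_Ioo.prod measurableSet_ball)).enorm.pow_const (3 / 2 : ℝ)
    rw [Measure.volume_eq_prod, ← Measure.prod_restrict] at h
    exact h
  have hYeq : ∫⁻ q in Ioo (-2 : ℝ) (-1) ×ˢ ball (0 : EuclideanSpace ℝ (Fin 3)) a, ‖p q.1 q.2‖ₑ ^ (3 / 2 : ℝ) =
      ∫⁻ τ in Ioo (-2 : ℝ) (-1), ∫⁻ x in ball (0 : EuclideanSpace ℝ (Fin 3)) a, ‖p τ x‖ₑ ^ (3 / 2 : ℝ) := by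
    rw [Measure.volume_eq_prod, ← Measure.prod_restrict, lintegral_prod _ hpmW]
  have hY : ∫⁻ τ in Ioo (-2 : ℝ) (-1), ∫⁻ x in ball (0 : EuclideanSpace ℝ (Fin 3)) a, ‖p τ x‖ₑ ^ (3 / 2 : ℝ) ≤ X := by
    rw [← hYeq]; exact lintegral_mono_set hWsub
  -- ### (3) pointwise power mean and Tonelli for the slice-pressure family
  have hvolI : volume (Ioo (-2 : ℝ) (-1)) = 1 := by
    rw [Real.volume_Ioo, show (-1 : ℝ) - -2 = 1 by ring, ENNReal.ofReal_one]
  have hJ : ∀ z : EuclideanSpace ℝ (Fin 3), ‖∫ τ in Ioo (-2 : ℝ) (-1), Ps τ z‖ₑ ^ (3 / 2 : ℝ) ≤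
      ∫⁻ τ in Ioo (-2 : ℝ) (-1), ‖Ps τ z‖ₑ ^ (3 / 2 : ℝ) := by
    intro z
    refine BreatherRigidity.enorm_setIntegral_rpow_le hvolI ?_
    exact ((continuousOn_slicePressure_time (g := g) hcl hT₀ z).mono (fun t ht => by
      have := ht.2; rw [mem_Iio]; linarith)).aestronglyMeasurable measurableSet_Ioo
  have hPsm : AEMeasurable (uncurry fun (z : EuclideanSpace ℝ (Fin 3)) (τ : ℝ) => ‖Ps τ z‖ₑ ^ (3 / 2 : ℝ))
      (((volume : Measure (EuclideanSpace ℝ (Fin 3))).restrict (ball 0 L)).prod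
        ((volume : Measure ℝ).restrict (Ioo (-2 : ℝ) (-1)))) := by
    have hsw : Continuous fun w : EuclideanSpace ℝ (Fin 3) × ℝ => ((w.2, w.1) : ℝ × EuclideanSpace ℝ (Fin 3)) := by fun_prop
    have hF0 := hcont.comp (hsw.continuousOn (s := ball (0 : EuclideanSpace ℝ (Fin 3)) L ×ˢ Ioo (-2 : ℝ) (-1)))
      (fun w hw => ⟨by have := hw.2.2; rw [mem_Iio]; linarith, mem_univ _⟩)
    have hF : ContinuousOn (fun w : EuclideanSpace ℝ (Fin 3) × ℝ => Ps w.2 w.1)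
        (ball (0 : EuclideanSpace ℝ (Fin 3)) L ×ˢ Ioo (-2 : ℝ) (-1)) := by
      refine hF0.congr fun w _ => ?_
      simp only [Function.comp_apply, hPs]
    have h : AEMeasurable (fun w : EuclideanSpace ℝ (Fin 3) × ℝ => ‖Ps w.2 w.1‖ₑ ^ (3 / 2 : ℝ))
        (volume.restrict (ball (0 : EuclideanSpace ℝ (Fin 3)) L ×ˢ Ioo (-2 : ℝ) (-1))) :=
      (hF.aestronglyMeasurable (measurableSet_ball.prod measurableSet_Ioo)).enorm.pow_const (3 / 2 : ℝ)
    rw [Measure.volume_eq_prod, ← Measure.prod_restrict] at h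
    exact h
  have hswap : ∫⁻ z in ball (0 : EuclideanSpace ℝ (Fin 3)) L, ∫⁻ τ in Ioo (-2 : ℝ) (-1), ‖Ps τ z‖ₑ ^ (3 / 2 : ℝ) =
      ∫⁻ τ in Ioo (-2 : ℝ) (-1), ∫⁻ z in ball (0 : EuclideanSpace ℝ (Fin 3)) L, ‖Ps τ z‖ₑ ^ (3 / 2 : ℝ) :=
    lintegral_lintegral_swap hPsm
  -- ### (4) the slices: `∫_{B_L}|P_τ|^{3/2} ≤ KA·KB ∫_{B_a}|p(τ)|^{3/2}` for `τ ∈ (−2,−1)`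
  have hslice : ∀ τ ∈ Ioo (-2 : ℝ) (-1), ∫⁻ z in ball (0 : EuclideanSpace ℝ (Fin 3)) L, ‖Ps τ z‖ₑ ^ (3 / 2 : ℝ) ≤
      ENNReal.ofReal KA * (ENNReal.ofReal KB * ∫⁻ x in ball (0 : EuclideanSpace ℝ (Fin 3)) a, ‖p τ x‖ₑ ^ (3 / 2 : ℝ)) := by
    intro τ hτ
    have hs : 0 < T₀ - τ := by have := hτ.2; linarith
    have hs1 : 1 ≤ T₀ - τ := by have := hτ.2; linarith
    have hsS : T₀ - τ ≤ S := by have := hτ.1; rw [hS]; linarith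
    set ℓ : ℝ := (T₀ - τ) ^ g with hℓ
    have hℓ0 : 0 < ℓ := Real.rpow_pos_of_pos hs _
    have hℓ1 : ℓ ≤ 1 := Real.rpow_le_one_of_one_le_of_nonpos hs1 hg0
    -- the amplitude factor `((s^{γ−1})²)⁻¹ = s^{2−2γ} ≤ S^{2−2γ}`
    have hampR : (((T₀ - τ) ^ (g - 1)) ^ 2)⁻¹ ≤ S ^ (2 - 2 * g) := by
      have e1 : (((T₀ - τ) ^ (g - 1)) ^ 2)⁻¹ = (T₀ - τ) ^ (2 - 2 * g) := by
        rw [← Real.rpow_natCast, ← Real.rpow_mul hs.le, ← Real.rpow_neg hs.le]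
        congr 1; push_cast; ring
      rw [e1]
      exact Real.rpow_le_rpow hs.le hsS (by linarith)
    have hamp0 : 0 ≤ (((T₀ - τ) ^ (g - 1)) ^ 2)⁻¹ := by positivity
    have hamp : ‖(((T₀ - τ) ^ (g - 1)) ^ 2)⁻¹‖ₑ ^ (3 / 2 : ℝ) ≤ ENNReal.ofReal KA := by
      have h2 : ‖(((T₀ - τ) ^ (g - 1)) ^ 2)⁻¹‖ₑ ≤ ENNReal.ofReal (S ^ (2 - 2 * g)) := by
        rw [Real.enorm_eq_ofReal hamp0]
        exact ENNReal.ofReal_le_ofReal hampR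
      calc ‖(((T₀ - τ) ^ (g - 1)) ^ 2)⁻¹‖ₑ ^ (3 / 2 : ℝ) ≤ ENNReal.ofReal (S ^ (2 - 2 * g)) ^ (3 / 2 : ℝ) :=
            ENNReal.rpow_le_rpow h2 (by norm_num)
        _ = ENNReal.ofReal KA := by
            rw [hKA, ENNReal.ofReal_rpow_of_nonneg (Real.rpow_nonneg hS0.le _) (by norm_num)]
    -- pointwise
    have hpt : ∀ z, ‖Ps τ z‖ₑ ^ (3 / 2 : ℝ) ≤ ENNReal.ofReal KA * ‖p τ (ℓ • z)‖ₑ ^ (3 / 2 : ℝ) := by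
      intro z
      simp only [hPs, hℓ]
      rw [enorm_mul, ENNReal.mul_rpow_of_nonneg _ _ (by norm_num : (0 : ℝ) ≤ 3 / 2)]
      exact mul_le_mul' hamp le_rfl
    -- the dilation `z ↦ ℓ z` (`ℓ ≤ 1`, `ℓ^{−3} = (T₀−τ)^{−3γ} ≤ S^{−3γ}`)
    have hdil : ∫⁻ z in ball (0 : EuclideanSpace ℝ (Fin 3)) L, ‖p τ (ℓ • z)‖ₑ ^ (3 / 2 : ℝ) ≤
        ENNReal.ofReal KB * ∫⁻ x in ball (0 : EuclideanSpace ℝ (Fin 3)) a, ‖p τ x‖ₑ ^ (3 / 2 : ℝ) := by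
      rw [lintegral_ball_comp_smul (fun x => ‖p τ x‖ₑ ^ (3 / 2 : ℝ)) hℓ0 L]
      have h1 : (ℓ ^ 3)⁻¹ ≤ KB := by
        have e1 : (ℓ ^ 3)⁻¹ = (T₀ - τ) ^ (-(3 * g)) := by
          rw [hℓ, ← Real.rpow_natCast, ← Real.rpow_mul hs.le, ← Real.rpow_neg hs.le]
          congr 1; push_cast; ring
        rw [e1, hKB]
        exact Real.rpow_le_rpow hs.le hsS (by linarith)
      have h2 : ℓ * L ≤ a := by rw [ha]; nlinarith
      exact mul_le_mul' (ENNReal.ofReal_le_ofReal h1) (lintegral_mono_set (ball_subset_ball h2))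
    calc ∫⁻ z in ball (0 : EuclideanSpace ℝ (Fin 3)) L, ‖Ps τ z‖ₑ ^ (3 / 2 : ℝ)
        ≤ ∫⁻ z in ball (0 : EuclideanSpace ℝ (Fin 3)) L, ENNReal.ofReal KA * ‖p τ (ℓ • z)‖ₑ ^ (3 / 2 : ℝ) :=
          lintegral_mono fun z => hpt z
      _ = ENNReal.ofReal KA * ∫⁻ z in ball (0 : EuclideanSpace ℝ (Fin 3)) L, ‖p τ (ℓ • z)‖ₑ ^ (3 / 2 : ℝ) :=
          lintegral_const_mul' _ _ ENNReal.ofReal_ne_top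
      _ ≤ ENNReal.ofReal KA * (ENNReal.ofReal KB * ∫⁻ x in ball (0 : EuclideanSpace ℝ (Fin 3)) a, ‖p τ x‖ₑ ^ (3 / 2 : ℝ)) :=
          mul_le_mul' le_rfl hdil
  -- ### (5) assemble
  calc ∫⁻ z in ball (0 : EuclideanSpace ℝ (Fin 3)) L, ‖∫ τ in Ioo (-2 : ℝ) (-1), Ps τ z‖ₑ ^ (3 / 2 : ℝ)
      ≤ ∫⁻ z in ball (0 : EuclideanSpace ℝ (Fin 3)) L, ∫⁻ τ in Ioo (-2 : ℝ) (-1), ‖Ps τ z‖ₑ ^ (3 / 2 : ℝ) :=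
        lintegral_mono fun z => hJ z
    _ = ∫⁻ τ in Ioo (-2 : ℝ) (-1), ∫⁻ z in ball (0 : EuclideanSpace ℝ (Fin 3)) L, ‖Ps τ z‖ₑ ^ (3 / 2 : ℝ) := hswap
    _ ≤ ∫⁻ τ in Ioo (-2 : ℝ) (-1), ENNReal.ofReal KA * (ENNReal.ofReal KB *
          ∫⁻ x in ball (0 : EuclideanSpace ℝ (Fin 3)) a, ‖p τ x‖ₑ ^ (3 / 2 : ℝ)) :=
        setLIntegral_mono_ae' measurableSet_Ioo (Eventually.of_forall fun τ hτ => hslice τ hτ)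
    _ = ENNReal.ofReal KA * (ENNReal.ofReal KB *
          ∫⁻ τ in Ioo (-2 : ℝ) (-1), ∫⁻ x in ball (0 : EuclideanSpace ℝ (Fin 3)) a, ‖p τ x‖ₑ ^ (3 / 2 : ℝ)) := by
        rw [lintegral_const_mul' _ _ ENNReal.ofReal_ne_top, lintegral_const_mul' _ _ ENNReal.ofReal_ne_top]
    _ ≤ ENNReal.ofReal KA * (ENNReal.ofReal KB * X) := mul_le_mul' le_rfl (mul_le_mul' le_rfl hY)
    _ ≤ ENNReal.ofReal KA * (ENNReal.ofReal KB * (ENNReal.ofReal (a ^ (2 - 2 * ρ)) * (c₀ : ℝ≥0∞))) :=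
        mul_le_mul' le_rfl (mul_le_mul' le_rfl hXle)
    _ = ENNReal.ofReal (KA * KB) * (c₀ : ℝ≥0∞) * ENNReal.ofReal (L ^ (2 - 2 * ρ)) := by
        rw [ha, ENNReal.ofReal_mul hKA0]
        ring

end PowerClockRigidity

end Summit.NavierStokesRegularity.NavierStokesRegularity.Theorems.PowerGaugeEulerLiouville

end
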